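import Summits.QuantumFields.BalabanUV.Beta.WilsonStencilReflection2
import Summits.QuantumFields.BalabanUV.Beta.SecondOrderStepLaw

/-!
# `BalabanUV.Beta.WilsonReflectionContact2` — binder row D1, W-side leaf (W-0W), stage S3c: **THE `(2,2)` AXIS-REFLECTION LAW OF
# an3's WILSON BI-STENCIL IN an2's `conjW` FORM — NO REMAINDER, AND THE TABLE NORMALISATION THAT MAKES THE OWNER'S CANONICAL
# READING EXACT** (β sub-cell, row BETA-an3, lineage an3 gen 32)

HONEST FRAMING (cell charter, verbatim): «discharging BetaPertH makes Balaban's UV stability UNCONDITIONAL — a real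
constructive-QFT result; it is NOT the continuum limit and NOT the Clay problem.»  Neutral kernel algebra ([folklore]) on OUR tables; no
statement of Bałaban's papers, no `[cite:]`, no `Prop` fact; instantiates no binder of the wall.  NOT D1, NOT `BetaPertH`, NOT continuum,
NOT Clay.

THE RESULTS.
* §3 `wilsonW₂_wsym22_bref` (packed, all fibre blocks): for every axis `α`, window parameter `L` and fine bonds `(κ₁,u₁)`, `(κ₂,u₂)` of `ℤ^{d+1}`,
  `wilsonW₂ d (wsym22 N) κ₁ (bref α κ₁ u₁) κ₂ (bref α κ₂ u₂) = (ε_κ₁ ε_κ₂) • refK (Φ L α) (wilsonW₂ d (wsym22 N) κ₁ u₁ κ₂ u₂ + conjW P E₁ E₂ X₁ X₂ X₁₂)`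
  with `P := wilsonP d N` (field block `(8N²)⁻¹·(d*d δ_{(b,z)})_a(x)`), `Eⱼ := wilsonA d κⱼ uⱼ`, `Xⱼ := diagK (−4N²·ctGen d α L κⱼ uⱼ)`,
  `X₁₂ := diagK (16N⁴·ctGen·ctGen′)` — the S3b law `WilsonStencilReflection2.bondPairTab_wsym22_bref` with its contact IDENTIFIED: `conjW₁`
  carries the first-order cut terms, `conjW₂` the two curl–curl contact lines; NO remainder.
* §4 `wilsonW₂_bref_ff_canon` (+ `_bhKAt`): read at the table `(8N²)⁻¹ • wsym22 N`, the `ff` entries obey VERBATIM the hypothesis `hQff` of the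
  row owner's `SecondOrderZeroCanon.quarticZero_bref_of_ffLaw` (p217218) with `Q := wilsonW₂ d ((8N²)⁻¹ • wsym22 N)`, `E := wilsonA d`,
  `κ₁ := −½` (THE coefficient of the first-order law `WilsonReflectionContact.wilsonA_bref`), the CANONICAL second symbol `κ₁²·ĝ·ĝ′`, ANY
  bordered `𝕄` whose field–field block is the window-free `d*d` entry (unit weight; e.g. `bhKAt d ρ L′`), and `R₀ := 0`.  The two locks
  (`κ₁ = −½` from `conjW₁`, unit weight from `conjW₂`) are met by ONE scalar `(8N²)⁻¹` — a consistency check of the first- and second-order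
  tables, decided by the kernel; `wilsonW₂_inr_left/right`, `wilsonA_inr_left/right` are the owner's `hQl/hQr/hEl/hEr`.
§1 the weight kernel, the second-order symbol and the units lock `bhKAt =ff= 8N²·wilsonP`; §2 the field–field entry of the contact = the S3b
contact line (`conjW_wilson_inl_inl`, indicator bookkeeping + one weight identity).  NOT HERE: the border sector, the owner's assembly.
Provenance: β sub-cell, unit beta-an3 gen 32, 2026-08-20 (v1); no existing file touched.
-/

namespace Summit.QuantumFields.BalabanUV.Beta.WilsonReflectionContact2

open Literature.MathematicalPhysics.QuantumFieldTheory.Balaban1983to89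
open Literature.MathematicalPhysics.QuantumFieldTheory.Balaban1983to89.Beta
open ColourTrace (Complete TrOrthonormal)
open WilsonVertex2Kron (bondPairTab)
open WilsonVertex2Sym (wsym22)
open WilsonBiStencil (wEntry₂ wilsonW₂ wilsonW₂_inl_inl wilsonW₂_inl_inr wilsonW₂_inr_inl wilsonW₂_inr_inr wilsonW₂_smul)
open StepJetData (wilsonA)
open ResolventReflection (bref Φ Φ_r_inl Φ_s_inl)
open PolarizationSign (reflSign)
open KernelReflection (refK refK_apply)
open ExpKernelCalculus (MKer)
open OneStepResolventKernel (Fib)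
open AffineAveraging (curv curvAdj)
open KKTFluctuationKernel (delta1)
open B6BondElimination (unitVec)
open Summit.QuantumFields.BalabanUV.Beta.ChartConjugation (conjW)
open Summit.QuantumFields.BalabanUV.Beta.BorderedHessian (diagK ctGen ctGen_inl curvAdj_curv_delta1_symm bhKAt bhKAt_inl_inl bhK_inl_inl_eq)
open Summit.QuantumFields.BalabanUV.Beta.SecondOrderStepLaw (conjW_diag_apply)
open Summit.QuantumFields.BalabanUV.Beta.WilsonReflectionFrame (Lc S₀A)
open Summit.QuantumFields.BalabanUV.Beta.WilsonReflectionContact (wilsonA_inl_inl wilsonA_inl_inr wilsonA_inr_inl wilsonA_inr_inr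
  curvAdj_curv_delta1_eq_two_mul_Lc)
open Summit.QuantumFields.BalabanUV.Beta.WilsonStencilReflection2 (bondPairTab_wsym22_bref)

noncomputable section

variable {d : ℕ}

/-! ## §1 The weight kernel and the second-order symbol -/

section Data

/-- **THE WILSON WEIGHT KERNEL** `wilsonP d N`: field–field block `(8N²)⁻¹ · (d*d δ_{(b,z)})_a(x)` (the window-free `d*d` entry of
`WilsonReflectionContact`, weighted), zero on every block touching a multiplier leg.  A definition asserting nothing. [folklore] -/
def wilsonP (d N : ℕ) : MKer (d + 1) (Fib d) :=
  fun x z a b =>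
    match a, b with
    | Sum.inl a, Sum.inl b => (8 * (N : ℝ) ^ 2)⁻¹ * curvAdj (curv (delta1 b z)) a x
    | Sum.inl _, Sum.inr _ => 0
    | Sum.inr _, Sum.inl _ => 0
    | Sum.inr _, Sum.inr _ => 0

/-- **THE SECOND-ORDER SYMBOL** `wilsonHH`: `16N⁴ · ctGen(κ₁,u₁) · ctGen(κ₂,u₂)`, the pointwise product of an2's two product-chart generators
(on a field leg: `16N⁴·[p = u₁ = u₂ ∧ c = κ₁ = κ₂ = α]`).  A definition asserting nothing. [folklore] -/
def wilsonHH (d N : ℕ) (α : Fin (d + 1)) (L : ℕ) (κ₁ : Fin (d + 1)) (u₁ : Fin (d + 1) → ℤ) (κ₂ : Fin (d + 1)) (u₂ : Fin (d + 1) → ℤ) :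
    (Fin (d + 1) → ℤ) → Fib d → ℝ :=
  fun p c => 16 * (N : ℝ) ^ 4 * (ctGen d α L κ₁ u₁ p c * ctGen d α L κ₂ u₂ p c)

variable (N : ℕ)

/-- the field–field entries of the weight kernel. [folklore] -/
theorem wilsonP_inl_inl (x z : Fin (d + 1) → ℤ) (a b : Fin (d + 1)) :
    wilsonP d N x z (Sum.inl a) (Sum.inl b) = (8 * (N : ℝ) ^ 2)⁻¹ * curvAdj (curv (delta1 b z)) a x := rfl

/-- the weight kernel vanishes on the field–multiplier block. [folklore] -/
theorem wilsonP_inl_inr (x z : Fin (d + 1) → ℤ) (a b : Fin (d + 1)) : wilsonP d N x z (Sum.inl a) (Sum.inr b) = 0 := rfl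

/-- the weight kernel vanishes on the multiplier–field block. [folklore] -/
theorem wilsonP_inr_inl (x z : Fin (d + 1) → ℤ) (a b : Fin (d + 1)) : wilsonP d N x z (Sum.inr a) (Sum.inl b) = 0 := rfl

/-- the weight kernel vanishes on the multiplier–multiplier block. [folklore] -/
theorem wilsonP_inr_inr (x z : Fin (d + 1) → ℤ) (a b : Fin (d + 1)) : wilsonP d N x z (Sum.inr a) (Sum.inr b) = 0 := rfl

/-- **THE UNITS LOCK**: the field–field block of an2's rooted bordered Hessian `bhKAt d ρ L` (any root, any window parameter) is `8N²`
times that of the weight kernel — the owner's `hff` with `w := 8N²`. [folklore] -/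
theorem bhKAt_inl_inl_eq_mul_wilsonP (hN : N ≠ 0) (ρ : Fin (d + 1) → ℤ) (L : ℕ) (x z : Fin (d + 1) → ℤ) (a b : Fin (d + 1)) :
    bhKAt d ρ L x z (Sum.inl a) (Sum.inl b) = 8 * (N : ℝ) ^ 2 * wilsonP d N x z (Sum.inl a) (Sum.inl b) := by
  rw [bhKAt_inl_inl, bhK_inl_inl_eq, wilsonP_inl_inl, ← mul_assoc,
    mul_inv_cancel₀ (mul_ne_zero (by norm_num) (pow_ne_zero 2 (Nat.cast_ne_zero.mpr hN))), one_mul]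

end Data

/-! ## §2 The field–field entry of the contact is the S3b contact line -/

section Entry

variable {N : ℕ}

/-- [folklore] **THE CONTACT, FIELD–FIELD ENTRY**: with `P := wilsonP d N`, letters `wilsonA d κⱼ uⱼ`, generators `−4N²·ctGen d α L κⱼ uⱼ` and
symbol `wilsonHH`, the entry `(x, inl a; z, inl b)` of an2's `conjW` IS the contact line of `WilsonStencilReflection2.bondPairTab_wsym22_bref`
at the legs `(x,a)`, `(z,b)` (first-order cut terms from `conjW₁`; the `Lc` lines from `conjW₂`, the contact functional being half the `d*d`
entry on the cut-off supports). -/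
theorem conjW_wilson_inl_inl (hN : N ≠ 0) (L : ℕ) (α κ₁ κ₂ : Fin (d + 1)) (u₁ u₂ x z : Fin (d + 1) → ℤ) (a b : Fin (d + 1)) :
    conjW (wilsonP d N) (wilsonA d κ₁ u₁) (wilsonA d κ₂ u₂) (diagK fun p c => -(4 * (N : ℝ) ^ 2) * ctGen d α L κ₁ u₁ p c)
        (diagK fun p c => -(4 * (N : ℝ) ^ 2) * ctGen d α L κ₂ u₂ p c) (diagK (wilsonHH d N α L κ₁ u₁ κ₂ u₂)) x z (Sum.inl a) (Sum.inl b) =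
      -(4 * (N : ℝ) ^ 2) * ((if x = u₂ ∧ a = α ∧ α = κ₂ then S₀A unitVec u₁ κ₁ (x, a) (z, b) else 0)
          - (if z = u₂ ∧ b = α ∧ α = κ₂ then S₀A unitVec u₁ κ₁ (x, a) (z, b) else 0)
          + (if x = u₁ ∧ a = α ∧ α = κ₁ then S₀A unitVec u₂ κ₂ (x, a) (z, b) else 0)
          - (if z = u₁ ∧ b = α ∧ α = κ₁ then S₀A unitVec u₂ κ₂ (x, a) (z, b) else 0))
      + 4 * (N : ℝ) ^ 2 * ((if z = u₁ ∧ b = α ∧ u₁ = u₂ ∧ α = κ₁ ∧ α = κ₂ then Lc unitVec α u₁ (x, a) else 0)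
          + (if x = u₁ ∧ a = α ∧ u₁ = u₂ ∧ α = κ₁ ∧ α = κ₂ then Lc unitVec α u₁ (z, b) else 0))
      - 4 * (N : ℝ) ^ 2 * ((if (x = u₁ ∧ a = α) ∧ (z = u₂ ∧ b = α) ∧ α = κ₁ ∧ α = κ₂ then Lc unitVec α u₂ (u₁, α) else 0)
          + (if (z = u₁ ∧ b = α) ∧ (x = u₂ ∧ a = α) ∧ α = κ₁ ∧ α = κ₂ then Lc unitVec α u₂ (u₁, α) else 0)) := by
  -- the contact functional on the cut-off supports is half the `d*d` entry `D := (d*d δ_{(b,z)})_a(x)`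
  have br₁ : (if z = u₁ ∧ b = α ∧ u₁ = u₂ ∧ α = κ₁ ∧ α = κ₂ then Lc unitVec α u₁ (x, a) else 0) =
      (if z = u₁ ∧ b = α ∧ u₁ = u₂ ∧ α = κ₁ ∧ α = κ₂ then (1 / 2 : ℝ) * curvAdj (curv (delta1 b z)) a x else 0) := by
    split_ifs with h
    · obtain ⟨rfl, rfl, -⟩ := h
      rw [curvAdj_curv_delta1_symm, curvAdj_curv_delta1_eq_two_mul_Lc]; ring
    · rfl
  have br₂ : (if x = u₁ ∧ a = α ∧ u₁ = u₂ ∧ α = κ₁ ∧ α = κ₂ then Lc unitVec α u₁ (z, b) else 0) =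
      (if x = u₁ ∧ a = α ∧ u₁ = u₂ ∧ α = κ₁ ∧ α = κ₂ then (1 / 2 : ℝ) * curvAdj (curv (delta1 b z)) a x else 0) := by
    split_ifs with h
    · obtain ⟨rfl, rfl, -⟩ := h
      rw [curvAdj_curv_delta1_eq_two_mul_Lc]; ring
    · rfl
  have br₃ : (if (x = u₁ ∧ a = α) ∧ (z = u₂ ∧ b = α) ∧ α = κ₁ ∧ α = κ₂ then Lc unitVec α u₂ (u₁, α) else 0) =
      (if (x = u₁ ∧ a = α) ∧ (z = u₂ ∧ b = α) ∧ α = κ₁ ∧ α = κ₂ then (1 / 2 : ℝ) * curvAdj (curv (delta1 b z)) a x else 0) := by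
    split_ifs with h
    · obtain ⟨⟨rfl, rfl⟩, ⟨rfl, hb⟩, -⟩ := h
      rw [hb, curvAdj_curv_delta1_symm, curvAdj_curv_delta1_eq_two_mul_Lc]; ring
    · rfl
  have br₄ : (if (z = u₁ ∧ b = α) ∧ (x = u₂ ∧ a = α) ∧ α = κ₁ ∧ α = κ₂ then Lc unitVec α u₂ (u₁, α) else 0) =
      (if (z = u₁ ∧ b = α) ∧ (x = u₂ ∧ a = α) ∧ α = κ₁ ∧ α = κ₂ then (1 / 2 : ℝ) * curvAdj (curv (delta1 b z)) a x else 0) := by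
    split_ifs with h
    · obtain ⟨⟨rfl, rfl⟩, ⟨rfl, ha⟩, -⟩ := h
      rw [ha, curvAdj_curv_delta1_eq_two_mul_Lc]; ring
    · rfl
  rw [br₁, br₂, br₃, br₄, conjW_diag_apply, wilsonA_inl_inl, wilsonA_inl_inl, wilsonP_inl_inl]
  simp only [wilsonHH, ctGen_inl]
  -- every cut-off as an indicator times its value
  have hval : ∀ (P : Prop) [Decidable P] (v : ℝ), (if P then v else 0) = (if P then (1 : ℝ) else 0) * v := by
    intro P _ v; split_ifs <;> simp
  have hneg : ∀ (P : Prop) [Decidable P], (if P then (-1 : ℝ) else 0) = -(if P then (1 : ℝ) else 0) := by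
    intro P _; split_ifs <;> simp
  simp only [hval _ (S₀A unitVec u₁ κ₁ (x, a) (z, b)), hval _ (S₀A unitVec u₂ κ₂ (x, a) (z, b)),
    hval _ ((1 / 2 : ℝ) * curvAdj (curv (delta1 b z)) a x), hneg]
  -- the indicator identities between the two books of cut-offs
  have I₁ : ∀ (p u : Fin (d + 1) → ℤ) (c κ : Fin (d + 1)),
      (if p = u ∧ c = α ∧ α = κ then (1 : ℝ) else 0) = (if p = u ∧ c = κ ∧ κ = α then (1 : ℝ) else 0) :=
    fun p u c κ => if_congr ⟨fun h => ⟨h.1, h.2.1.trans h.2.2, h.2.2.symm⟩, fun h => ⟨h.1, h.2.1.trans h.2.2, h.2.2.symm⟩⟩ rfl rfl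
  have I₂ : ∀ (p : Fin (d + 1) → ℤ) (c : Fin (d + 1)), (if p = u₁ ∧ c = α ∧ u₁ = u₂ ∧ α = κ₁ ∧ α = κ₂ then (1 : ℝ) else 0) =
      (if p = u₁ ∧ c = κ₁ ∧ κ₁ = α then (1 : ℝ) else 0) * (if p = u₂ ∧ c = κ₂ ∧ κ₂ = α then (1 : ℝ) else 0) := by
    intro p c
    by_cases h : p = u₁ ∧ c = α ∧ u₁ = u₂ ∧ α = κ₁ ∧ α = κ₂
    · rw [if_pos h, if_pos ⟨h.1, h.2.1.trans h.2.2.2.1, h.2.2.2.1.symm⟩,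
        if_pos ⟨h.1.trans h.2.2.1, h.2.1.trans h.2.2.2.2, h.2.2.2.2.symm⟩, mul_one]
    · rw [if_neg h]
      split_ifs with k₁ k₂
      · exact (h ⟨k₁.1, k₁.2.1.trans k₁.2.2, k₁.1.symm.trans k₂.1, k₁.2.2.symm, k₂.2.2.symm⟩).elim
      all_goals simp
  have I₄ : ∀ (p q : Fin (d + 1) → ℤ) (c e : Fin (d + 1)), (if (p = u₁ ∧ c = α) ∧ (q = u₂ ∧ e = α) ∧ α = κ₁ ∧ α = κ₂ then (1 : ℝ) else 0) =
      (if p = u₁ ∧ c = κ₁ ∧ κ₁ = α then (1 : ℝ) else 0) * (if q = u₂ ∧ e = κ₂ ∧ κ₂ = α then (1 : ℝ) else 0) := by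
    intro p q c e
    by_cases h : (p = u₁ ∧ c = α) ∧ (q = u₂ ∧ e = α) ∧ α = κ₁ ∧ α = κ₂
    · rw [if_pos h, if_pos ⟨h.1.1, h.1.2.trans h.2.2.1, h.2.2.1.symm⟩, if_pos ⟨h.2.1.1, h.2.1.2.trans h.2.2.2, h.2.2.2.symm⟩, mul_one]
    · rw [if_neg h]
      split_ifs with k₁ k₂
      · exact (h ⟨⟨k₁.1, k₁.2.1.trans k₁.2.2⟩, ⟨k₂.1, k₂.2.1.trans k₂.2.2⟩, k₁.2.2.symm, k₂.2.2.symm⟩).elim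
      all_goals simp
  rw [I₁ x u₂ a κ₂, I₁ z u₂ b κ₂, I₁ x u₁ a κ₁, I₁ z u₁ b κ₁, I₂ z b, I₂ x a, I₄ x z a b, I₄ z x b a]
  -- the weight: `(8N²)⁻¹ · 16N⁴ = 2N²`
  have hN' : (N : ℝ) ≠ 0 := Nat.cast_ne_zero.mpr hN
  have h8 : (8 * (N : ℝ) ^ 2)⁻¹ * (16 * (N : ℝ) ^ 4) = 2 * (N : ℝ) ^ 2 := by field_simp; ring
  linear_combination (curvAdj (curv (delta1 b z)) a x *
      ((if x = u₁ ∧ a = κ₁ ∧ κ₁ = α then (1 : ℝ) else 0) * (if x = u₂ ∧ a = κ₂ ∧ κ₂ = α then (1 : ℝ) else 0)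
        + (if z = u₁ ∧ b = κ₁ ∧ κ₁ = α then (1 : ℝ) else 0) * (if z = u₂ ∧ b = κ₂ ∧ κ₂ = α then (1 : ℝ) else 0)
        - (if x = u₁ ∧ a = κ₁ ∧ κ₁ = α then (1 : ℝ) else 0) * (if z = u₂ ∧ b = κ₂ ∧ κ₂ = α then (1 : ℝ) else 0)
        - (if x = u₂ ∧ a = κ₂ ∧ κ₂ = α then (1 : ℝ) else 0) * (if z = u₁ ∧ b = κ₁ ∧ κ₁ = α then (1 : ℝ) else 0))) * h8

end Entry

/-! ## §3 The law -/

section Law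

variable {N : ℕ} {C : Type*} [Fintype C] [DecidableEq C] {τ : C → Matrix (Fin N) (Fin N) ℂ}

/-- [folklore] **HEADLINE — THE `(2,2)` AXIS-REFLECTION LAW OF THE WILSON BI-STENCIL IN `conjW` FORM, NO REMAINDER**: for an orthonormal
complete colour basis (`N ≠ 0`), every axis `α`, window parameter `L` and bonds `(κ₁,u₁)`, `(κ₂,u₂)`,
`wilsonW₂ d (wsym22 N) κ₁ (bref α κ₁ u₁) κ₂ (bref α κ₂ u₂) = (ε_κ₁ ε_κ₂) • refK (Φ L α) (wilsonW₂ d (wsym22 N) κ₁ u₁ κ₂ u₂ + conjW P E₁ E₂ X₁ X₂ X₁₂)`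
with `P := wilsonP d N`, `Eⱼ := wilsonA d κⱼ uⱼ`, `Xⱼ := diagK (−4N²·ctGen d α L κⱼ uⱼ)`, `X₁₂ := diagK (wilsonHH d N α L κ₁ u₁ κ₂ u₂)` — the
hypothesis `hQ` of `SecondOrderZeroLaw.quarticZero_bref_of_laws` for `Q := wilsonW₂ d (wsym22 N)`, `E := wilsonA d`, `κ₁ := −4N²`, `R₀ := 0`. -/
theorem wilsonW₂_wsym22_bref (hτ : Complete τ) (ho : TrOrthonormal τ) (hN : N ≠ 0) (c : C) (L : ℕ) (α κ₁ κ₂ : Fin (d + 1))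
    (u₁ u₂ : Fin (d + 1) → ℤ) :
    wilsonW₂ d (wsym22 N) κ₁ (bref α κ₁ u₁) κ₂ (bref α κ₂ u₂) =
      (reflSign α κ₁ * reflSign α κ₂) • refK (Φ L α)
        (wilsonW₂ d (wsym22 N) κ₁ u₁ κ₂ u₂ + conjW (wilsonP d N) (wilsonA d κ₁ u₁) (wilsonA d κ₂ u₂)
          (diagK fun p c => -(4 * (N : ℝ) ^ 2) * ctGen d α L κ₁ u₁ p c) (diagK fun p c => -(4 * (N : ℝ) ^ 2) * ctGen d α L κ₂ u₂ p c)
          (diagK (wilsonHH d N α L κ₁ u₁ κ₂ u₂))) := by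
  funext x z e f
  simp only [Pi.smul_apply, Pi.add_apply, smul_eq_mul, refK_apply]
  rcases e with a | a <;> rcases f with b | b
  · rw [Φ_s_inl, Φ_s_inl, Φ_r_inl, Φ_r_inl, wilsonW₂_inl_inl, wilsonW₂_inl_inl, conjW_wilson_inl_inl hN]
    simp only [wEntry₂]
    rw [bondPairTab_wsym22_bref hτ ho hN c]
    ring
  · rw [wilsonW₂_inl_inr, wilsonW₂_inl_inr, conjW_diag_apply, wilsonA_inl_inr, wilsonA_inl_inr, wilsonP_inl_inr]; ring
  · rw [wilsonW₂_inr_inl, wilsonW₂_inr_inl, conjW_diag_apply, wilsonA_inr_inl, wilsonA_inr_inl, wilsonP_inr_inl]; ring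
  · rw [wilsonW₂_inr_inr, wilsonW₂_inr_inr, conjW_diag_apply, wilsonA_inr_inr, wilsonA_inr_inr, wilsonP_inr_inr]; ring

/-- [folklore] **THE SAME LAW, FIELD–FIELD ENTRY** (legs `X = bref α a x`, `Z = bref α b z`). -/
theorem wilsonW₂_wsym22_bref_inl_inl (hτ : Complete τ) (ho : TrOrthonormal τ) (hN : N ≠ 0) (c : C) (L : ℕ) (α κ₁ κ₂ : Fin (d + 1))
    (u₁ u₂ x z : Fin (d + 1) → ℤ) (a b : Fin (d + 1)) :
    wilsonW₂ d (wsym22 N) κ₁ (bref α κ₁ u₁) κ₂ (bref α κ₂ u₂) x z (Sum.inl a) (Sum.inl b) =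
      reflSign α κ₁ * reflSign α κ₂ * (reflSign α a * reflSign α b *
        (wilsonW₂ d (wsym22 N) κ₁ u₁ κ₂ u₂ (bref α a x) (bref α b z) (Sum.inl a) (Sum.inl b) +
          conjW (wilsonP d N) (wilsonA d κ₁ u₁) (wilsonA d κ₂ u₂) (diagK fun p c => -(4 * (N : ℝ) ^ 2) * ctGen d α L κ₁ u₁ p c)
            (diagK fun p c => -(4 * (N : ℝ) ^ 2) * ctGen d α L κ₂ u₂ p c) (diagK (wilsonHH d N α L κ₁ u₁ κ₂ u₂)) (bref α a x) (bref α b z)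
            (Sum.inl a) (Sum.inl b))) := by
  rw [wilsonW₂_wsym22_bref hτ ho hN c L]
  simp only [Pi.smul_apply, Pi.add_apply, smul_eq_mul, refK_apply, Φ_s_inl, Φ_r_inl]

end Law

/-! ## §4 The law in the row owner's canonical units (`κ₁ = −½`, unit field weight, canonical second symbol) -/

section Canon

variable {N : ℕ} {C : Type*} [Fintype C] [DecidableEq C] {τ : C → Matrix (Fin N) (Fin N) ℂ}

/-- [folklore] **THE TABLE NORMALISATION LOCK — THE LAW `ff`-ENTRYWISE IN CANONICAL UNITS**: with the Wilson bi-stencil read at the table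
`(8N²)⁻¹ • wsym22 N`, the `ff` entries obey VERBATIM the hypothesis `hQff` of `SecondOrderZeroCanon.quarticZero_bref_of_ffLaw` with
`Q := wilsonW₂ d ((8N²)⁻¹ • wsym22 N)`, `E := wilsonA d`, THE FIRST-ORDER COEFFICIENT `κ₁ := −½` OF `WilsonReflectionContact.wilsonA_bref`, the
CANONICAL second symbol `κ₁²·ĝ·ĝ′`, ANY bordered kernel `𝕄` whose field–field block is the window-free `d*d` entry (unit weight), and
`R₀ := 0`.  (Both locks — `κ₁ = −½` from `conjW₁` and unit weight from `conjW₂` — are met by the ONE scalar `(8N²)⁻¹`: a consistency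
check of the first- and second-order tables decided by the kernel.) -/
theorem wilsonW₂_bref_ff_canon (hτ : Complete τ) (ho : TrOrthonormal τ) (hN : N ≠ 0) (c : C) (𝕄 : MKer (d + 1) (Fib d))
    (h𝕄 : ∀ (x z : Fin (d + 1) → ℤ) (a b : Fin (d + 1)), 𝕄 x z (Sum.inl a) (Sum.inl b) = curvAdj (curv (delta1 b z)) a x) (L : ℕ)
    (α κ₁ κ₂ : Fin (d + 1)) (u₁ u₂ x z : Fin (d + 1) → ℤ) (β β' : Fin (d + 1)) :
    wilsonW₂ d ((8 * (N : ℝ) ^ 2)⁻¹ • wsym22 N) κ₁ (bref α κ₁ u₁) κ₂ (bref α κ₂ u₂) x z (Sum.inl β) (Sum.inl β') =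
      ((reflSign α κ₁ * reflSign α κ₂) • refK (Φ (d := d) L α)
        (wilsonW₂ d ((8 * (N : ℝ) ^ 2)⁻¹ • wsym22 N) κ₁ u₁ κ₂ u₂ +
          conjW 𝕄 (wilsonA d κ₁ u₁) (wilsonA d κ₂ u₂) (diagK fun p c => (-(1 / 2) : ℝ) * ctGen d α L κ₁ u₁ p c)
            (diagK fun p c => (-(1 / 2) : ℝ) * ctGen d α L κ₂ u₂ p c)
            (diagK fun p c => (-(1 / 2) : ℝ) ^ 2 * (ctGen d α L κ₁ u₁ p c * ctGen d α L κ₂ u₂ p c)))) x z (Sum.inl β) (Sum.inl β') := by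
  have hN' : (N : ℝ) ≠ 0 := Nat.cast_ne_zero.mpr hN
  simp only [wilsonW₂_smul]
  rw [wilsonW₂_wsym22_bref hτ ho hN c L]
  simp only [Pi.smul_apply, Pi.add_apply, smul_eq_mul, refK_apply, Φ_s_inl, Φ_r_inl, conjW_diag_apply, h𝕄, wilsonP_inl_inl, wilsonHH]
  field_simp
  ring

/-- [folklore] The same with the row owner's rooted bordered Hessian `𝕄 := bhKAt d ρ L'` (any root, any window parameter). -/
theorem wilsonW₂_bref_ff_canon_bhKAt (hτ : Complete τ) (ho : TrOrthonormal τ) (hN : N ≠ 0) (c : C) (ρ : Fin (d + 1) → ℤ) (L' L : ℕ)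
    (α κ₁ κ₂ : Fin (d + 1)) (u₁ u₂ x z : Fin (d + 1) → ℤ) (β β' : Fin (d + 1)) :
    wilsonW₂ d ((8 * (N : ℝ) ^ 2)⁻¹ • wsym22 N) κ₁ (bref α κ₁ u₁) κ₂ (bref α κ₂ u₂) x z (Sum.inl β) (Sum.inl β') =
      ((reflSign α κ₁ * reflSign α κ₂) • refK (Φ (d := d) L α)
        (wilsonW₂ d ((8 * (N : ℝ) ^ 2)⁻¹ • wsym22 N) κ₁ u₁ κ₂ u₂ +
          conjW (bhKAt d ρ L') (wilsonA d κ₁ u₁) (wilsonA d κ₂ u₂) (diagK fun p c => (-(1 / 2) : ℝ) * ctGen d α L κ₁ u₁ p c)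
            (diagK fun p c => (-(1 / 2) : ℝ) * ctGen d α L κ₂ u₂ p c)
            (diagK fun p c => (-(1 / 2) : ℝ) ^ 2 * (ctGen d α L κ₁ u₁ p c * ctGen d α L κ₂ u₂ p c)))) x z (Sum.inl β) (Sum.inl β') :=
  wilsonW₂_bref_ff_canon hτ ho hN c _ (fun x z a b => by rw [bhKAt_inl_inl, bhK_inl_inl_eq]) L α κ₁ κ₂ u₁ u₂ x z β β'

/-- [folklore] the Wilson bi-stencil vanishes on a left multiplier leg (the owner's `hQl`). -/
theorem wilsonW₂_inr_left (T : Fin 4 → Fin 4 → Fin 4 → Fin 4 → ℝ) (κ : Fin (d + 1)) (u : Fin (d + 1) → ℤ) (κ' : Fin (d + 1))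
    (u' x z : Fin (d + 1) → ℤ) (m : Fin (d + 1)) (b : Fib d) : wilsonW₂ d T κ u κ' u' x z (Sum.inr m) b = 0 := by
  cases b <;> rfl

/-- [folklore] the Wilson bi-stencil vanishes on a right multiplier leg (the owner's `hQr`). -/
theorem wilsonW₂_inr_right (T : Fin 4 → Fin 4 → Fin 4 → Fin 4 → ℝ) (κ : Fin (d + 1)) (u : Fin (d + 1) → ℤ) (κ' : Fin (d + 1))
    (u' x z : Fin (d + 1) → ℤ) (a : Fib d) (m : Fin (d + 1)) : wilsonW₂ d T κ u κ' u' x z a (Sum.inr m) = 0 := by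
  cases a <;> rfl

/-- [folklore] the Wilson table vanishes on a left multiplier leg (the owner's `hEl`). -/
theorem wilsonA_inr_left (κ : Fin (d + 1)) (u x z : Fin (d + 1) → ℤ) (m : Fin (d + 1)) (b : Fib d) :
    wilsonA d κ u x z (Sum.inr m) b = 0 := by
  cases b <;> rfl

/-- [folklore] the Wilson table vanishes on a right multiplier leg (the owner's `hEr`). -/
theorem wilsonA_inr_right (κ : Fin (d + 1)) (u x z : Fin (d + 1) → ℤ) (a : Fib d) (m : Fin (d + 1)) :
    wilsonA d κ u x z a (Sum.inr m) = 0 := by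
  cases a <;> rfl

end Canon

end

end Summit.QuantumFields.BalabanUV.Beta.WilsonReflectionContact2
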